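import Literature.AlgebraicTopology.CharacteristicClasses.LineThomClassUnion
import Literature.AlgebraicTopology.CharacteristicClasses.LineThomClassExistence
import HarnessLib

/-!
# Uniqueness of the Thom class of a complex line bundle

J. Milnor, J. Stasheff, *Characteristic Classes* (1974), §10 Thm. 10.4 (uniqueness half) with its
proof pp. 111–113, for a complex LINE bundle `λ` over a paracompact Hausdorff base in the absolute
form on `D = P(λ ⊕ ℂ)` (`LineThomClassExistence.IsThomClass`):

**`IsThomClass.unique`**: two Thom classes (same generator `m`) coincide.

Proof. (1) FINITE STAGES (`isFibreDetected_exhaustion`, `isPulledBack_exhaustion_one`): over the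
exhaustion `V_n = W_0 ∪ ⋯ ∪ W_n` of the existence proof, fibre detection in degree `2` and
"degree-`1` classes are pulled back from the base" hold, by induction on `n` through the pair-sequence
step `LineThomClassUnion` (Milnor–Stasheff's Mayer–Vietoris induction), the levels `W_n` being
disjoint unions of trivialisable sets (`LineThomClassLowDegree`). Hence `y = t − t'` vanishes on
every `D_{V_n}`. (2) PASSAGE TO THE LIMIT (`eq_zero_of_forall_map_subsetIncl_exhaustion_eq_zero`,
the injectivity counterpart of `CohomologyOpenExhaustion`, valid here because the relevant `lim¹`
obstruction is killed by the normalisation `s_∞^* y = 0`): at cochain level, `y = [φ]`,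
`s_∞^♯ φ = δb`, and on each `D_{V_n}` there are NORMALISED primitives `c_n` (`δ c_n = φ|`,
`s_∞^♯ c_n = b|`); two of them on consecutive stages differ on `D_{V_n}` by a `1`-cocycle killed by
`s_∞^♯`, which is a coboundary `δe` by (1) in degree `1`; correcting `c_{n+1}` by `δ(ext e)` and
re-normalising makes the primitives EXACTLY compatible, so they glue (`glueSeq`) to a global
primitive of `φ`: `y = 0`. Everything is proved; no named facts.

## References

* J. Milnor, J. Stasheff, *Characteristic Classes*, PUP 1974, §10 Thm. 10.4, pp. 111–113. [MilnorStasheff1974]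
* A. Hatcher, *Algebraic Topology*, CUP 2002, §3.F (Thm. 3F.8, `lim¹`). [HatcherAT2002]
-/

noncomputable section

open CategoryTheory Function Set Bundle Literature.AlgebraicTopology.SingularHomology
open scoped LinearAlgebra.Projectivization

universe u

namespace Literature.AlgebraicTopology.CharacteristicClasses

variable {B : Type u} [TopologicalSpace B] (F : Type u) [NormedAddCommGroup F] [NormedSpace ℂ F] [FiniteDimensional ℂ F]
  (E : B → Type u) [∀ b, AddCommGroup (E b)] [∀ b, Module ℂ (E b)]
  [TopologicalSpace (TotalSpace F E)] [∀ b, TopologicalSpace (E b)] [FiberBundle F E] [VectorBundle ℂ F E]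
  (hF : Module.finrank ℂ F = 1) (R : Type u) [CommRing R]

/-! ### Finite stages: detection properties of the levels and of the exhaustion -/

section Finite

variable [T2Space B] [ParacompactSpace B]
variable {F E}

/-- Over `V ∩ W_n` (`V` open), degree-`≤ 1` classes are pulled back from the base. [folklore] -/
theorem isPulledBack_inter_levelSet {V : Set B} (hV : IsOpen V) (n : ℕ) {k : ℕ} (hk : k ≤ 1) :
    IsPulledBack F E hF R (V ∩ levelSet F E n) k := by
  rw [levelSet, inter_iUnion]
  refine isPulledBack_iUnion hF R (fun S ↦ hV.inter (isOpen_levelPiece F E n S))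
    (fun S T hST ↦ (pairwise_disjoint_levelPiece F E n hST).mono inter_subset_right inter_subset_right) fun S ↦ ?_
  obtain ⟨i, hi⟩ := levelPiece_subset F E n S
  haveI := i.2
  exact isPulledBack_of_subset_baseSet hF R i.1 (inter_subset_right.trans hi) hk

/-- Over `W_n`, degree-one classes killed by `s_∞^*` vanish. [folklore] -/
theorem isInfDetected_levelSet_one (n : ℕ) : IsInfDetected F E hF R (levelSet F E n) 1 := by
  rw [levelSet]
  refine isInfDetected_iUnion hF R (isOpen_levelPiece F E n) (pairwise_disjoint_levelPiece F E n) fun S ↦ ?_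
  obtain ⟨i, hi⟩ := levelPiece_subset F E n S
  haveI := i.2
  exact isInfDetected_of_subset_baseSet hF R i.1 hi le_rfl

/-- Over `W_n`, fibre detection holds. [folklore] -/
theorem isFibreDetected_levelSet (n : ℕ) : IsFibreDetected F E hF R (levelSet F E n) := by
  rw [levelSet]
  refine isFibreDetected_iUnion hF R (isOpen_levelPiece F E n) (pairwise_disjoint_levelPiece F E n) fun S ↦ ?_
  obtain ⟨i, hi⟩ := levelPiece_subset F E n S
  haveI := i.2
  exact isFibreDetected_of_subset_baseSet hF R i.1 hi

/-- **Over every `V_n`, degree-one classes killed by `s_∞^*` vanish** (induction on `n` through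
`isInfDetected_union`). [cite: MilnorStasheff1974, §10 pp. 111–113] -/
theorem isInfDetected_exhaustion_one : ∀ n, IsInfDetected F E hF R (exhaustion F E n) 1
  | 0 => isInfDetected_levelSet_one hF R 0
  | n + 1 => isInfDetected_union hF R (isOpen_exhaustion F E n) (isOpen_levelSet F E (n + 1))
      (isInfDetected_exhaustion_one n) (isInfDetected_levelSet_one hF R (n + 1))
      (isPulledBack_inter_levelSet hF R (isOpen_exhaustion F E n) (n + 1) (Nat.zero_le 1))

/-- Over every `V_n`, degree-one classes are pulled back from the base. [cite: MilnorStasheff1974, §10 pp. 111–113] -/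
theorem isPulledBack_exhaustion_one (n : ℕ) : IsPulledBack F E hF R (exhaustion F E n) 1 :=
  (isInfDetected_exhaustion_one hF R n).isPulledBack

/-- **Over every `V_n`, fibre detection holds** (uniqueness of the Thom class for the finite-type
stages; induction on `n` through `isFibreDetected_union`). [cite: MilnorStasheff1974, §10 Thm. 10.4] -/
theorem isFibreDetected_exhaustion : ∀ n, IsFibreDetected F E hF R (exhaustion F E n)
  | 0 => isFibreDetected_levelSet hF R 0
  | n + 1 => isFibreDetected_union hF R (isOpen_exhaustion F E n) (isOpen_levelSet F E (n + 1))
      (isFibreDetected_exhaustion n) (isFibreDetected_levelSet hF R (n + 1))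
      (isPulledBack_inter_levelSet hF R (isOpen_exhaustion F E n) (n + 1) le_rfl)

end Finite

/-! ### Cochain-level generalities -/

section Cochains

variable {X Y Z : Type u} [TopologicalSpace X] [TopologicalSpace Y] [TopologicalSpace Z]

/-- `(g ∘ f)^♯ = f^♯ ∘ g^♯` on cochains, applied. [folklore] -/
theorem sharp_comp (f : C(X, Y)) (g : C(Y, Z)) (n : ℕ) (c : (singularCochainComplex R R Z).X n) :
    (singularCochainComplex.map R R (g.comp f)).f n c =
      (singularCochainComplex.map R R f).f n ((singularCochainComplex.map R R g).f n c) := by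
  rw [singularCochainComplex.map_comp, HomologicalComplex.comp_f, ModuleCat.comp_apply]

/-- `f^♯` commutes with the coboundary, applied. [folklore] -/
theorem sharp_d (f : C(X, Y)) (i j : ℕ) (c : (singularCochainComplex R R Y).X i) :
    (singularCochainComplex.map R R f).f j ((singularCochainComplex R R Y).d i j c) =
      (singularCochainComplex R R X).d i j ((singularCochainComplex.map R R f).f i c) := by
  rw [← ModuleCat.comp_apply, ← (singularCochainComplex.map R R f).comm i j, ModuleCat.comp_apply]

/-- `δ ∘ δ = 0`, applied. [folklore] -/
theorem d_d_apply (i j k : ℕ) (c : (singularCochainComplex R R X).X i) :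
    (singularCochainComplex R R X).d j k ((singularCochainComplex R R X).d i j c) = 0 := by
  rw [← ModuleCat.comp_apply, HomologicalComplex.d_comp_d]
  rfl

/-- `𝟙^♯ = 𝟙`, applied. [folklore] -/
theorem sharp_id (n : ℕ) (c : (singularCochainComplex R R X).X n) :
    (singularCochainComplex.map R R (ContinuousMap.id X)).f n c = c := by
  rw [singularCochainComplex.map_id]
  rfl

end Cochains

/-! ### Passage to the limit: normalised primitives -/

section Limit

variable [T2Space B] [ParacompactSpace B]
variable {F E}

/-- **A degree-two class on `P(λ ⊕ ℂ)` killed by `s_∞^*` and vanishing on every `D_{V_n}` is zero**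
(Milnor–Stasheff §10, the passage from finite type to a paracompact base; the `lim¹`-type
obstruction vanishes thanks to the normalisation along the section at infinity: normalised
primitives on the stages can be made exactly compatible and glue). [cite: MilnorStasheff1974, §10 pp. 111–113] -/
theorem eq_zero_of_forall_map_subsetIncl_exhaustion_eq_zero (y : singularCohomology R R (ProjCompl F E) 2)
    (hs : singularCohomology.map R R (complInf F E hF) 2 y = 0)
    (hn : ∀ n, singularCohomology.map R R (subsetIncl (complPreimage F E (exhaustion F E n))) 2 y = 0) : y = 0 := by
  -- notation
  set V' : ℕ → Set (ProjCompl F E) := fun n ↦ complPreimage F E (exhaustion F E n) with hV'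
  have hV'o : ∀ n, IsOpen (V' n) := fun n ↦ (isOpen_exhaustion F E n).preimage (complProj F E).continuous
  have hmono : Monotone V' := fun a a' haa' ↦ preimage_mono (monotone_exhaustion F E haa')
  have hcov : ⋃ n, V' n = univ := by
    rw [hV']
    change ⋃ n, TotalSpace.proj ⁻¹' exhaustion F E n = univ
    rw [← preimage_iUnion, iUnion_exhaustion F E, preimage_univ]
  have hprev2 : (ComplexShape.up ℕ).prev 2 = 1 := CochainComplex.prev_nat_succ 1
  have hprev1 : (ComplexShape.up ℕ).prev 1 = 0 := CochainComplex.prev_nat_succ 0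
  have hnext1 : (ComplexShape.up ℕ).next 1 = 2 := CochainComplex.next ℕ 1
  -- the maps
  let ι : ∀ n, C(↥(V' n), ProjCompl F E) := fun n ↦ subsetIncl (V' n)
  let sN : ∀ n, C(↥(exhaustion F E n), ↥(V' n)) := fun n ↦ complInfOn F E hF (exhaustion F E n)
  let πN : ∀ n, C(↥(V' n), ↥(exhaustion F E n)) := fun n ↦ complProjOn F E (exhaustion F E n)
  let jN : ∀ n, C(↥(exhaustion F E n), B) := fun n ↦ subsetIncl (exhaustion F E n)
  let r : ∀ n, C(↥(V' n), ↥(V' (n + 1))) := fun n ↦ ContinuousMap.inclusion (hmono (Nat.le_succ n))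
  let rB : ∀ n, C(↥(exhaustion F E n), ↥(exhaustion F E (n + 1))) := fun n ↦
    ⟨Set.inclusion (monotone_exhaustion F E (Nat.le_succ n)), continuous_inclusion _⟩
  have e_πs : ∀ n, (πN n).comp (sN n) = ContinuousMap.id _ := fun n ↦ rfl
  have e_ιs : ∀ n, (ι n).comp (sN n) = (complInf F E hF).comp (jN n) := fun n ↦ rfl
  have e_ιr : ∀ n, (ι (n + 1)).comp (r n) = ι n := fun n ↦ rfl
  have e_rs : ∀ n, (r n).comp (sN n) = (sN (n + 1)).comp (rB n) := fun n ↦ rfl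
  have e_jr : ∀ n, (jN (n + 1)).comp (rB n) = jN n := fun n ↦ rfl
  have e_πr : ∀ n, (πN (n + 1)).comp (r n) = (rB n).comp (πN n) := fun n ↦ rfl
  -- a representing cocycle and a primitive of its restriction along `s_∞`
  obtain ⟨φ, hφ, rfl⟩ := homologyCls_surjective (K := singularCochainComplex R R (ProjCompl F E)) y
  obtain ⟨b, hb⟩ : ∃ b : (singularCochainComplex R R B).X 1,
      (singularCochainComplex R R B).d 1 2 b = (singularCochainComplex.map R R (complInf F E hF)).f 2 φ := by
    have h := hs
    change @Eq ((singularCochainComplex R R B).homology 2)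
      (HomologicalComplex.homologyMap (singularCochainComplex.map R R (complInf F E hF)) 2 (homologyCls φ hφ)) 0 at h
    rw [homologyMap_homologyCls, homologyCls_eq_zero_iff] at h
    obtain ⟨w, hw⟩ := h
    revert w
    rw [hprev2]
    intro w hw
    exact ⟨w, hw⟩
  -- primitives on the stages
  have hc : ∀ n, ∃ c : (singularCochainComplex R R ↥(V' n)).X 1,
      (singularCochainComplex R R ↥(V' n)).d 1 2 c = (singularCochainComplex.map R R (ι n)).f 2 φ := by
    intro n
    have h := hn n
    change @Eq ((singularCochainComplex R R ↥(V' n)).homology 2)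
      (HomologicalComplex.homologyMap (singularCochainComplex.map R R (ι n)) 2 (homologyCls φ hφ)) 0 at h
    rw [homologyMap_homologyCls, homologyCls_eq_zero_iff] at h
    obtain ⟨w, hw⟩ := h
    revert w
    rw [hprev2]
    intro w hw
    exact ⟨w, hw⟩
  -- normalised primitives
  let P : ∀ n, (singularCochainComplex R R ↥(V' n)).X 1 → Prop := fun n c ↦
    (singularCochainComplex R R ↥(V' n)).d 1 2 c = (singularCochainComplex.map R R (ι n)).f 2 φ ∧
      (singularCochainComplex.map R R (sN n)).f 1 c = (singularCochainComplex.map R R (jN n)).f 1 b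
  -- normalisation: subtract `π^♯ (s^♯ c − j^♯ b)`
  have hnorm : ∀ n (c : (singularCochainComplex R R ↥(V' n)).X 1),
      (singularCochainComplex R R ↥(V' n)).d 1 2 c = (singularCochainComplex.map R R (ι n)).f 2 φ →
      P n (c - (singularCochainComplex.map R R (πN n)).f 1
        ((singularCochainComplex.map R R (sN n)).f 1 c - (singularCochainComplex.map R R (jN n)).f 1 b)) := by
    intro n c hcn
    have hda : (singularCochainComplex R R ↥(exhaustion F E n)).d 1 2
        ((singularCochainComplex.map R R (sN n)).f 1 c - (singularCochainComplex.map R R (jN n)).f 1 b) = 0 := by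
      rw [map_sub, ← sharp_d, hcn, ← sharp_d, hb, ← sharp_comp, ← sharp_comp, e_ιs n, sub_self]
    constructor
    · rw [map_sub, hcn, ← sharp_d, hda, map_zero, sub_zero]
    · rw [map_sub, ← sharp_comp, e_πs n, sharp_id, sub_sub_cancel]
  have hP : ∀ n, ∃ c, P n c := fun n ↦ by
    obtain ⟨c, hcn⟩ := hc n
    exact ⟨_, hnorm n c hcn⟩
  -- the step: a normalised primitive on stage `n + 1` exactly restricting to a given one on stage `n`
  have hstep : ∀ n (c : (singularCochainComplex R R ↥(V' n)).X 1), P n c →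
      ∃ c' : (singularCochainComplex R R ↥(V' (n + 1))).X 1, P (n + 1) c' ∧
        (singularCochainComplex.map R R (r n)).f 1 c' = c := by
    intro n c hPc
    obtain ⟨c₁, hc₁⟩ := hP (n + 1)
    -- the difference on stage `n` is a cocycle killed by `s_∞^♯`, hence a coboundary `d e`
    set z := (singularCochainComplex.map R R (r n)).f 1 c₁ - c with hz
    have hdz : (singularCochainComplex R R ↥(V' n)).d 1 2 z = 0 := by
      rw [hz, map_sub, ← sharp_d, hc₁.1, ← sharp_comp, e_ιr n, hPc.1, sub_self]
    have hsz : (singularCochainComplex.map R R (sN n)).f 1 z = 0 := by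
      rw [hz, map_sub, ← sharp_comp, e_rs n, sharp_comp, hc₁.2, ← sharp_comp, e_jr n, hPc.2, sub_self]
    have hdz' : (singularCochainComplex R R ↥(V' n)).d 1 ((ComplexShape.up ℕ).next 1) z = 0 := by
      rw [hnext1]; exact hdz
    have hcls : homologyCls z hdz' = 0 := by
      refine isInfDetected_exhaustion_one hF R n (homologyCls z hdz') ?_
      change @Eq ((singularCochainComplex R R ↥(exhaustion F E n)).homology 1)
        (HomologicalComplex.homologyMap (singularCochainComplex.map R R (sN n)) 1 (homologyCls z hdz')) 0
      rw [homologyMap_homologyCls]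
      have h0 : (singularCochainComplex R R ↥(exhaustion F E n)).d 1 ((ComplexShape.up ℕ).next 1) 0 = 0 := map_zero _
      rw [← homologyCls_zero (K := singularCochainComplex R R ↥(exhaustion F E n)) (i := 1) h0]
      exact homologyCls_congr hsz _ _
    obtain ⟨e, he⟩ : ∃ e : (singularCochainComplex R R ↥(V' n)).X 0,
        (singularCochainComplex R R ↥(V' n)).d 0 1 e = z := by
      rw [homologyCls_eq_zero_iff] at hcls
      obtain ⟨w, hw⟩ := hcls
      revert w
      rw [hprev1]
      intro w hw
      exact ⟨w, hw⟩
    -- correct `c₁` by `d (ext e)`: exact compatibility, then re-normalise (which keeps it)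
    set c₃ := c₁ - (singularCochainComplex R R ↥(V' (n + 1))).d 0 1 (extendZero (hmono (Nat.le_succ n)) e) with hc₃
    have hrc₃ : (singularCochainComplex.map R R (r n)).f 1 c₃ = c := by
      rw [hc₃, map_sub, sharp_d, map_inclusion_extendZero, he, hz, sub_sub_cancel]
    have hdc₃ : (singularCochainComplex R R ↥(V' (n + 1))).d 1 2 c₃ = (singularCochainComplex.map R R (ι (n + 1))).f 2 φ := by
      rw [hc₃, map_sub, d_d_apply, sub_zero, hc₁.1]
    refine ⟨_, hnorm (n + 1) c₃ hdc₃, ?_⟩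
    rw [map_sub, hrc₃, sub_eq_self, ← sharp_comp, e_πr n, sharp_comp]
    have ha : (singularCochainComplex.map R R (rB n)).f 1
        ((singularCochainComplex.map R R (sN (n + 1))).f 1 c₃ - (singularCochainComplex.map R R (jN (n + 1))).f 1 b) = 0 := by
      rw [map_sub, ← sharp_comp, ← e_rs n, sharp_comp, hrc₃, hPc.2, ← sharp_comp, e_jr n, sub_self]
    rw [ha, map_zero]
  -- the exactly compatible sequence of normalised primitives (dependent choice along `hstep`)
  let seqP : ∀ n, {c : (singularCochainComplex R R ↥(V' n)).X 1 // P n c} := fun n ↦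
    Nat.rec (motive := fun n ↦ {c : (singularCochainComplex R R ↥(V' n)).X 1 // P n c})
      ⟨(hP 0).choose, (hP 0).choose_spec⟩
      (fun n prev ↦ ⟨(hstep n prev.1 prev.2).choose, (hstep n prev.1 prev.2).choose_spec.1⟩) n
  have hcompat : ∀ n, (singularCochainComplex.map R R (r n)).f 1 (seqP (n + 1)).1 = (seqP n).1 := fun n ↦
    (hstep n (seqP n).1 (seqP n).2).choose_spec.2
  -- glue them to a global primitive of `φ`
  set cg := glueSeq hV'o hmono hcov (fun n ↦ (seqP n).1) with hcg
  have hd : (singularCochainComplex R R (ProjCompl F E)).d 1 2 cg = φ := by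
    refine funext fun sx ↦ ?_
    obtain ⟨m, hm⟩ := SingularSimplex.exists_range_subset_of_exhaustion hV'o hmono hcov sx
    change (singularCochainComplex R R (ProjCompl F E)).d 1 (1 + 1) cg sx = φ sx
    rw [hcg, d_glueSeq_apply hV'o hmono hcov (fun n ↦ (seqP n).1) hcompat sx hm]
    change (singularCochainComplex R R ↥(V' m)).d 1 2 (seqP m).1 _ = _
    rw [(seqP m).2.1, singularCochainComplex.map_apply, SingularSimplex.codRestrict_map_val]
  change @Eq ((singularCochainComplex R R (ProjCompl F E)).homology 2) (homologyCls φ hφ) 0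
  rw [homologyCls_eq_zero_iff, hprev2]
  exact ⟨cg, hd⟩

/-- **Uniqueness of the Thom class of a complex line bundle** over a paracompact Hausdorff base
(Milnor–Stasheff Thm. 10.4, uniqueness half, absolute form on `P(λ ⊕ ℂ)`): two Thom classes with
the same generator coincide. [cite: MilnorStasheff1974, §10 Thm. 10.4] -/
theorem IsThomClass.unique {m : R} {t t' : singularCohomology R R (ProjCompl F E) 2}
    (ht : IsThomClass F E hF R m t) (ht' : IsThomClass F E hF R m t') : t = t' := by
  rw [← sub_eq_zero]
  refine eq_zero_of_forall_map_subsetIncl_exhaustion_eq_zero hF R (t - t') ?_ fun n ↦ ?_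
  · rw [map_sub, ht.map_complInf, ht'.map_complInf, sub_self]
  · refine isFibreDetected_exhaustion hF R n _ ?_ fun b hb ↦ ?_
    · rw [← ModuleCat.comp_apply, ← singularCohomology.map_comp, subsetIncl_comp_complInfOn F E hF,
        singularCohomology.map_comp, ModuleCat.comp_apply, map_sub, ht.map_complInf, ht'.map_complInf, sub_self,
        map_zero]
    · rw [← ModuleCat.comp_apply, ← singularCohomology.map_comp, subsetIncl_comp_complFibOn F E hb, map_sub,
        ht.map_complFibreIncl, ht'.map_complFibreIncl, sub_self]

end Limit

end Literature.AlgebraicTopology.CharacteristicClasses
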